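import Summits.BirchSwinnertonDyer.BirchSwinnertonDyer.Theses.TameQuarticManinParity
import Summits.BirchSwinnertonDyer.BirchSwinnertonDyer.Theorems.ResidualThetaTransportAtTwoThetaLayerLambdaCongruenceAtTwoSdTorsionShapiroCount
import HarnessLib

/-!
# Route TameQuarticManinParity, LINE 36 — M36 `ModPrimeEllipticParabolicCocycleBound`
# (stmt-BirchSwinnertonDyer-23968): the mod-`ℓ` elliptic–parabolic cocycle bound, BY NAME

For every level `N ≥ 1` and every prime `ℓ`, an `𝔽_ℓ`-linearly-independent family of ADDITIVE maps
`u_i : Γ₀(N) → 𝔽_ℓ` killing every parabolic and every elliptic element of `Γ₀(N)` has at most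
`2 dim_ℂ S₂(Γ₀(N))` members.

The mathematics is ALREADY in the tree, for an arbitrary field `K` of coefficients (characteristic `2`, `3`
included): the space `parEllCocycles K N` of such maps and the characteristic-free Shimura/Shapiro count
`finrank_parEllCocycles_le_two_mul_finrank : dim_K parEllCocycles K N ≤ 2 dim_ℂ S₂(Γ₀(N))`
(`…Theorems.ResidualThetaTransportAtTwoThetaLayerLambdaCongruenceAtTwoSdTorsionShapiroCount`, namespace
`…Theorems.SdTorsion.ParabolicCountK`, width seat bsd-wall-rtt-p3-w4 of the `ℓ = 2` programme: Shapiro lift to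
`K^X`, `u(-1) = 0` from `-1 = (-T)T⁻¹`, the elliptic hypothesis replacing the characteristic-zero trace identities,
kernels counted orbit by orbit, and the tree's genus formula `twelve_mul_finrank_cuspForm_two_gamma0_holds`).  This
file is the one-step specialisation `K = ZMod ℓ`: the family `u` is a linearly independent family IN the
finite-dimensional space `parEllCocycles (ZMod ℓ) N`, so its cardinality is at most that dimension.

No new definition, no named fact, no `sorry`; standard axioms.  BSD is not proved by this; Knapp's Prop. 11.22
(`periodFunctional_ker_le_ellipticParabolic_sup_commutator`) follows only together with the glue G36
(stmt-BirchSwinnertonDyer-23969).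
-/

set_option autoImplicit false
-- D-0017: single-problem summit, so `Summit.BirchSwinnertonDyer.BirchSwinnertonDyer.…` repeats a namespace BY DESIGN.
set_option linter.dupNamespace false

noncomputable section

open scoped MatrixGroups ModularForm

open CongruenceSubgroup

namespace Summit.BirchSwinnertonDyer.BirchSwinnertonDyer.Theorems.TameQuarticManinParity

open Summit.BirchSwinnertonDyer.BirchSwinnertonDyer.Theorems.SdTorsion
open Summit.BirchSwinnertonDyer.BirchSwinnertonDyer.Theorems.SdTorsion.ParabolicCountK

/-- **M36 (LINE 36, stmt-BirchSwinnertonDyer-23968) `ModPrimeEllipticParabolicCocycleBound`.** For every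
level `N ≥ 1` and prime `ℓ`, an `𝔽_ℓ`-linearly-independent family of additive maps `Γ₀(N) → 𝔽_ℓ` killing every
parabolic and every elliptic element has at most `2 dim_ℂ S₂(Γ₀(N))` members: the family lies in the
finite-dimensional `𝔽_ℓ`-space `parEllCocycles (ZMod ℓ) N` (`finite_parEllCocycles`), is linearly independent
there (`LinearIndependent.of_comp` along the subtype inclusion), so its cardinality is at most
`dim parEllCocycles (ZMod ℓ) N ≤ 2 dim_ℂ S₂(Γ₀(N))` (`finrank_parEllCocycles_le_two_mul_finrank`, the
characteristic-free Shapiro count of the tree). [folklore] -/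
theorem modPrimeEllipticParabolicCocycleBound_proof :
    Summit.BirchSwinnertonDyer.BirchSwinnertonDyer.Theses.TameQuarticManinParity.ModPrimeEllipticParabolicCocycleBound := by
  intro N _ ℓ _ ι _ u hadd hkill hli
  haveI := finite_parEllCocycles (ZMod ℓ) N
  let v : ι → parEllCocycles (ZMod ℓ) N := fun i ↦
    ⟨u i, hadd i, fun γ hγ ↦ hkill i γ (Or.inl hγ), fun γ hγ ↦ hkill i γ (Or.inr hγ)⟩
  have hv : LinearIndependent (ZMod ℓ) v :=
    LinearIndependent.of_comp (parEllCocycles (ZMod ℓ) N).subtype hli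
  calc Fintype.card ι ≤ Module.finrank (ZMod ℓ) (parEllCocycles (ZMod ℓ) N) :=
        hv.fintype_card_le_finrank
    _ ≤ 2 * Module.finrank ℂ (CuspForm (Gamma0 N) 2) :=
        finrank_parEllCocycles_le_two_mul_finrank (ZMod ℓ) N

end Summit.BirchSwinnertonDyer.BirchSwinnertonDyer.Theorems.TameQuarticManinParity

end
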